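import Summits.ResolutionOfSingularities.ResolutionOfSingularities.Theorems.FibrewiseClosedPoints.Negative.AlmostDecoration
import Summits.ResolutionOfSingularities.ResolutionOfSingularities.Theorems.FibrewiseClosedPoints.Negative.OneChartBlowup
import Summits.ResolutionOfSingularities.ResolutionOfSingularities.Theorems.FibrewiseClosedPoints.Negative.PrincipalCentre
import Summits.ResolutionOfSingularities.ResolutionOfSingularities.Theorems.FibrewiseClosedPoints.Negative.LoadBearing
import Summits.ResolutionOfSingularities.ResolutionOfSingularities.Theorems.FibrewiseClosedPoints.Negative.ExactSupport
import Summits.ResolutionOfSingularities.ResolutionOfSingularities.Theorems.FibrewiseClosedPoints.Negative.ConductorSupport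
import Summits.ResolutionOfSingularities.ResolutionOfSingularities.Theorems.SectionAscentGenericLevel
import Literature.AlgebraicGeometry.Resolution.AffineDomainDimension
import Literature.AlgebraicGeometry.Resolution.RegularLocalRingsNormal

/-!
# Disproof of `FibrewiseClosedPoints` — findings

Crux `stmt-ResolutionOfSingularities-15960`, route `ResolutionOfSingularities/SectionAscent`:
`FibrewiseClosedPoints = ∀ p prime, ∀ d, OneShot p d → Almost p (d+1) → OneShot p (d+1)` where
`OneShot p d` = strong ONE-SHOT resolution of integral affine varieties of dimension `< d` over
every field of characteristic `p` (one blowing up `Bl_I(Spec A)`, regular, `V(I) = Sing(Spec A)`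
exactly) and `Almost p d` = one normal blowing up with `V(I) ⊇ Sing`, regular off the points closed
in their fibre. Standing disprovers: refuter-cdisprove-stmt-ResolutionOfSingularities-15960-0
(generation 1, cycle 1, 2026-08-17, §§1–6), extending the seed of refuter-rattack-…-15960-0;
refuter-cdisprove-stmt-ResolutionOfSingularities-15960-g2-0 (generation 2, cycle 1, 2026-08-17, §7).

## Generation 2, cycle 1 (2026-08-17) — summary (details §7)

State at start: everything of generation 1 is LANDED (`Negative/AlmostDecoration` p149842,
`OneChartBlowup` p149778, `PrincipalCentre` p156365, `RestatesTarget` p151467, `LoadBearing`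
p156839); line `birth` is terminal with the two open stubs `stub_weakSectionLift`
(⟺ `OneShot p d → WeakOneShot p (d+1)`, `weakSectionLift_iff`) and `stub_supportSharpening`
(weak ⇒ strong one-shot); lead c1 picked NO line and recommends FREEZE behind the target / RESTATE;
`stuck_stubs = []`, no targets posted. No kill is possible (crux ≡ target, kernel). This cycle
attacks the REPAIR the route will need and lands two negative lemmas about the two clauses that
separate the conclusion `OneShot` from the hypothesis `Almost`:
* LANDED `Negative/ExactSupport.lean` (p163004): at a NORMAL variety with a singular point no
  principal (invertible) ideal satisfies the exact-support clause `I ≤ 𝔭 ↔ A_𝔭 singular` (Krull's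
  Hauptidealsatz: primes minimal over `(f)` are regular points of a normal variety), while every
  principal `(f)`, `D(f) ⊆ Reg`, satisfies the whole `Almost` body
  (`almostBody_and_not_exactSupport_span_singleton`); local form `exists_mem_and_lt_maximalIdeal`:
  the zero set of an invertible ideal at a point of dimension `≥ 2` is never the point — so a
  one-shot exact resolution has DIVISORIAL exceptional locus and a small strong resolution
  (`Bl_{(x,z)}` of `xy = zw`) is never one-shot.
* LANDED `Negative/ConductorSupport.lean` (p163578): the exact-support REPAIR of `Almost` is STILL
  junk-satisfied — by the finite normalisation `Spec Ã = D₊(f²t) = Bl_{f²Ã}(Spec A)` — at every `A`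
  whose singular locus is cut out by a conductor element `f` (`exactAlmostBody_of_conductor_elem`,
  and `not_isRegular_affineBlowup_of_conductor_elem`: that admissible blowing up is singular iff `Ã`
  is). PINCHING (paper, §7.2) produces such `A` with `Ã` ANY prescribed normal singular affine
  variety, in every characteristic and dimension `≥ 2`; hence the repaired crux still contains
  "strong one-shot below `d` ⇒ resolution of every normal affine `d`-fold" — the whole inductive
  step again. A repair must constrain the witness MODEL (e.g. run the induction over normal `A`
  only, where `ExactSupport` forbids finite witnesses at singular points), not only its support.
* §7.3 (paper): the one-shot PRESENTATION criterion behind `stub_supportSharpening` — a projective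
  `π : X' → Spec A`, `X'` regular, iso over `Reg`, is `Bl_I` with `V(I) = Sing` iff some effective
  Cartier `F` with `Supp F = π⁻¹(Sing)` exactly has `-F` `π`-ample (normal `A`; in general after
  principalising the conductor, `I = 𝔣 · Γ(𝒪(-NF))`); automatic for blow-up SEQUENCES with centres
  over `Sing` and, by the negativity lemma, for every strong projective resolution of a normal
  ℚ-factorial `A`; fails for small resolutions. So `OneShot p 4` is open exactly at non-ℚ-factorial
  normal threefolds and at the conductor principalisation (Cossart–Piltant resolve by PATCHING, not
  by a blow-up sequence) — generation 1's reading "open from `d = 3`" stands, now with the mechanism.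

## Verdict of cycle 1: NO KILL — and no kill is possible short of refuting the route target

* KERNEL: `crux_iff_target : FibrewiseClosedPoints ↔ OneShotAffine` (this file, §2; landed pieces:
  `Negative.AlmostDecoration.not_fibrewiseClosedPoints_of_not_oneShotAffine` +
  `Theorems.exists_ideal_almost_of_normalization`, the normalisation as a one-chart blowing up, by
  which `Almost p d` holds OUTRIGHT for all `p, d`). A counterexample to the crux is therefore an
  affine variety over a field of characteristic `p` NONE of whose `Sing`-cosupported ideals has a
  regular blowing up — an impossibility proof for resolutions; no finite, decidable or small-model
  shape exists, no `kit compute` search applies.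
* LOAD-BEARING ANALYSIS (§3, all kernel-checked): dropping `Almost p (d+1)` gives an EQUIVALENT
  statement (`iff_withoutAlmost`); dropping the induction hypothesis `OneShot p d` ALSO gives an
  equivalent statement (`iff_withoutOneShotHyp`); dropping `p.Prime` adds exactly the
  characteristic-`0` target (`withoutPrime_iff`: Hironaka's theorem in strong projective form,
  TRUE, not in the tree). Hence NO `_false_without_<H>` theorem exists for any hypothesis `H`
  unless `OneShotAffine` is false: the crux has no removable-but-necessary hypothesis to exhibit.
* LEVEL STRUCTURE (§4): `crux_iff_forall_succ : crux ↔ ∀ p prime, ∀ d, OneShot p (d+1)`; levels are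
  cumulative (`oneShot_antitone`), `OneShot p 0` vacuous, `OneShot p 1` landed (`oneShotBody_one`),
  so the instance `d = 0` of the crux holds (`crux_instance_zero`).
  STATUS IN PRINT, CORRECTED (the route header, `PICKED.md`, `Lines/birth.md` and the 07:55Z vetting
  note say "levels `d + 1 ≤ 4` true, first open instance `d = 4`", citing "CossartPiltant2019 Thm 1.1
  (i)(ii) + Liu2002 Thm 8.1.24"): Liu 2002 Thm 8.1.24 (p. 388, read) presents a projective birational
  morphism as SOME blowing up with NO control of the centre (support control is only Lemma 8.3.47 (a),
  finite morphisms), and Cossart–Piltant state VERBATIM (arXiv:1412.0868 p. 3, read): "it is not even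
  known if such π can be obtained by blowing up an ideal sheaf 𝓘 ⊆ 𝒪_𝒳 whose zero locus is Sing 𝒳,
  even when 𝒳 is affine." So `OneShot p 4` (threefolds) is an OPEN QUESTION of Cossart–Piltant, the
  first open instance of the crux is `d = 3`, and the target is open from DIMENSION 3. (Why the naive
  transfer fails: a projective `π : X' → Spec A`, iso over `Reg`, is `Bl_I` with `V(I) = Sing` iff some
  effective Cartier divisor `F` with support EXACTLY `π⁻¹(Sing)` has `-F` `π`-ample (then
  `I = 𝔠 · π_*𝒪(-nF)`-type ideals work, `𝔠` a conductor power); e.g. the small resolution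
  `Bl_{(x,z)}` of `xy = zw` is projective and iso off the vertex but is no `𝔪`-primary blowing up, its
  exceptional locus being a curve. Levels `≤ 3` survive: fields (Lean); curves — blow up the conductor,
  `Bl_𝔠(A) = Bl_𝔠(Ã) = Spec Ã` since the Rees algebras agree in positive degrees and `𝔠` is
  invertible on the Dedekind `Ã`; excellent surfaces — Lipman (Liu 2002 Thm 8.3.44) + negative
  definiteness of the exceptional curves over the normalisation gives an anti-ample fully supported
  `F`, principalise the conductor by further point blowing ups, multiply by `𝔠`.)
* LINE `registered` (`Lines/birth.lean`, lead prover-line-…-15960-0; §5): joint sufficiency of the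
  five stubs is kernel-checked in the skeleton (`FibrewiseClosedPoints_of`, sorry-free modulo stubs;
  nothing smuggled: `Almost` discarded, `OneShot p d` enters only `stub_weakSectionLift`). Per stub:
  - `stub_closedPointsSuffice`, `stub_lowDimPoint`: landed by the lead (p147124, p148953).
  - `stub_certificateRegular`: SOUND on paper (Cartier ascent: `(b)` + normality (S₂, principal ideals
    unmixed in `R(t)`) identify `V(ℓ')` with the strict transform near `P`; `ℓ' ≠ 0` by `(b)` at the
    generic point; EGA 0.17.1.7; flat descent `R → R(t)`); helpers landing (p149281–p152380).
    Mutation: `hnorm` and `hdim` are JOINTLY load-bearing and neither alone is droppable for free —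
    with both dropped the JUNK CERTIFICATE bites: cusp `A = K[x,y]/(y²-x³)`, `I = (x)` (`Bl_I ≅ Spec A`,
    landed `isIso_affineBlowup_π_span_singleton`), `y` = the cusp, `m = 1`, `g = (x²)`: (a) `x²/x = x ∈ 𝔪_y`;
    (b) the only proper generisation is the generic point and `x² ≠ 0`; (c) is VACUOUS — in
    `B = (K(t) ⊗ A)/(t ⊗ x²) = (A/(x²))_{K(t)}` the ideal `I·B = (x)` is nilpotent, so the Rees algebra
    `B[IBt]` has nilpotent irrelevant ideal and `Bl_{IB}(Spec B) = Proj B[IBt] = ∅` is regular; yet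
    `𝒪_y` (the cusp) is not regular. With `hnorm` kept, dimension `≤ 1` points are regular (R₁, the
    lead's `stub_lowDimPoint`); with `hdim > 1` kept, (b) forbids `I·B` nilpotent near `P` (a
    height-one prime `𝔮₀ ∋ c` of `Ã` through `y` would contain all `g_j/a^m`). Not formalised (needs
    the points/stalk dictionary of `Proj` for the cusp; recorded for the lead: the certificate's clause
    (c) carries NO information at points where `I·𝒪_{H_g}` is nilpotent).
  - `stub_weakSectionLift` (OPEN, hardest): implied on paper by WEAK one-shot resolution at level
    `d + 1` (given `Bl_I` regular take `g` = generators of `(𝔭_y)_m`, `m ≥` the generator degrees of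
    `𝔭_y`: base locus `{y}` exactly, hence (b); (c) off `P` by incidence Bertini on the REGULAR scheme
    `Bl_I ⊗_K K(t)` — a `ℙ^{s-1}`-bundle argument, every characteristic, no smoothness — and at `P`
    because the `c_j = g_j/a^m` generate `𝔪_y`, so some `c_j ∉ 𝔪_y²` and `R(t)/(ℓ')` is regular);
    conversely with the criterion it gives weak one-shot at level `d + 1`. So the stub is "strong
    below `d` ⇒ weak at `d + 1`", open from `d + 1 = 4` (weak projective resolution of fourfolds);
    not refutable here. Its `d = 0, 1` instances hold (fields: `I = ⊤`, empty family; curves: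
    `I = 𝔠`, `g` = generators of `𝔠^m 𝔫`).
  - `stub_supportSharpening` (OPEN): `supportSharpening_of_target` and
    `target_iff_weak_and_supportSharpening` (§5, kernel): the stub is implied by the target and is
    EXACTLY the gap weak ⇒ strong one-shot; in dimension 3 weak one-shot is in print (CP Thm 1.1 +
    Liu 8.1.24) while strong is CP's open question, so the stub is OPEN FROM DIMENSION 3 (the line
    card's "known in dim ≤ 3" holds in dim ≤ 2 only). Mutation: dropping `hreg` makes it the target
    itself; dropping `IsDomain` only adds the zero ring (hypothesis `I ≠ ⊥` unsatisfiable, vacuous).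
* TARGETS (lead's stuck stubs): none posted yet (payload `stuck_stubs = []`).
* NATURAL STRENGTHENINGS (§6): "the centre may be taken principal" is FALSE — KERNEL, landed
  `Negative/PrincipalCentre.lean` p156365: `Bl_(f) ≅ Spec A`, and the nodal cubic `Y² = X²(X-1)` over
  `𝔽_p` is a certified singular curve (Eisenstein at `(X-1)`; `f ∈ 𝔪_0²`), so even WEAK one-shot with
  principal centres fails at level `2` in every characteristic — the conclusion of the crux is not
  junk-satisfiable, unlike its hypothesis `Almost`; on paper: "the centre may be taken radical
  (= 𝓘_Sing)" is FALSE (`y² = x⁵`: `Bl_𝔪` has an `A₂` point); "the `Almost`-witness itself is regular" is FALSE (normalisation of a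
  normal singular surface); "weak ⇒ strong with the SAME centre up to radical" is FALSE (small
  resolution of `xy = zw`: centre `(x,z)` has zero set a plane). None is the crux.
* BARRIERS (catalogue `Literature/Barriers/ResolutionOfSingularities/`): `InseparableBaseChange`,
  `RegularNotGeometricallyRegular` concern smoothness under base change; the crux asks absolute
  regularity and base-changes only along `K → K(t)` (regular morphism) — they do not bite the
  STATEMENT (they bite naive proofs by spreading out, as the route header itself records).

Landed / proposed from this file's analysis (generation 1, cycle 1): `Theorems/FibrewiseClosedPoints/Negative/PrincipalCentre.lean`
— LANDED p156365 (§6: principal centres never resolve; the nodal cubic over `𝔽_p` is a certified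
singular curve; `not_weakOneShotBody_two_principal`, `not_oneShotBody_two_principal`);
`Theorems/FibrewiseClosedPoints/Negative/LoadBearing.lean` — LANDED p156839 (§§2–5 verbatim:
`fibrewiseClosedPoints_iff_oneShotAffine`, `…_iff_withoutAlmost`, `…_iff_withoutOneShotHyp`,
`…_iff_forall_succ`, `crux_instance_zero`, `supportSharpeningBody_of_oneShotAffine`,
`oneShotAffine_iff_weak_and_supportSharpening`); `Negative/RestatesTarget.lean` LANDED p151467.
Earlier: `Negative/AlmostDecoration.lean` (p149842), `Negative/OneChartBlowup.lean` (p149778).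
Generation 2, cycle 1: `Negative/ExactSupport.lean` LANDED p163004; `Negative/ConductorSupport.lean`
LANDED p163578 (§7).
-/

noncomputable section

-- single-problem summit: the doubled namespace component `ResolutionOfSingularities` is forced
set_option linter.dupNamespace false

open CategoryTheory AlgebraicGeometry TopologicalSpace
open Literature.AlgebraicGeometry.Resolution
open Summit.ResolutionOfSingularities.ResolutionOfSingularities.Theses.SectionAscent
open Summit.ResolutionOfSingularities.ResolutionOfSingularities.Theorems.FibrewiseClosedPoints.Negative

namespace Summit.ResolutionOfSingularities.ResolutionOfSingularities.Cruxes.FibrewiseClosedPoints.Disproof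

/-! ## §1 The route's `let`-predicates as named propositions (bodies verbatim) -/

/-- `OneShot p d`: strong one-shot resolution of integral affine varieties of dimension `< d` over
every field of characteristic `p` — one blowing up, regular, centre cosupported EXACTLY on the
non-regular locus (verbatim the route's `let OneShot`). [cite: CossartPiltant2019, p. 3 (open in dim 3)] -/
def OneShot (p d : ℕ) : Prop :=
  ∀ (K : Type) [Field K] [CharP K p] (A : Type) [CommRing A] [IsDomain A] [Algebra K A]
    [Algebra.FiniteType K A], ringKrullDim A < (d : WithBot ℕ∞) → ∃ I : Ideal A, I ≠ ⊥ ∧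
      Scheme.IsRegular (affineBlowup I) ∧
      ∀ 𝔭 : PrimeSpectrum A, I ≤ 𝔭.asIdeal ↔ ¬ IsRegularLocalRing (Localization.AtPrime 𝔭.asIdeal)

/-- `Almost p d`: one NORMAL blowing up with `V(I) ⊇ Sing`, regular at every point not closed in
its fibre (verbatim the route's `let Almost`; inhabited outright —
`Theorems.exists_ideal_almost_of_normalization`). [folklore] -/
def Almost (p d : ℕ) : Prop :=
  ∀ (K : Type) [Field K] [CharP K p] (A : Type) [CommRing A] [IsDomain A] [Algebra K A]
    [Algebra.FiniteType K A], ringKrullDim A < (d : WithBot ℕ∞) → ∃ I : Ideal A, I ≠ ⊥ ∧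
      (∀ 𝔭 : PrimeSpectrum A, ¬ I ≤ 𝔭.asIdeal → IsRegularLocalRing (Localization.AtPrime 𝔭.asIdeal)) ∧
      (∀ y : affineBlowup I, IsIntegrallyClosed ((affineBlowup I).presheaf.stalk y)) ∧
      ∀ y : affineBlowup I, (∃ z : affineBlowup I, z ≠ y ∧ y ⤳ z ∧
        (affineBlowup.π I).base z = (affineBlowup.π I).base y) →
        IsRegularLocalRing ((affineBlowup I).presheaf.stalk y)

/-- WEAK one-shot resolution at level `d`: SOME nonzero centre with regular blowing up (no
condition on the centre's zero set). [folklore] -/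
def WeakOneShot (p d : ℕ) : Prop :=
  ∀ (K : Type) [Field K] [CharP K p] (A : Type) [CommRing A] [IsDomain A] [Algebra K A]
    [Algebra.FiniteType K A], ringKrullDim A < (d : WithBot ℕ∞) → ∃ I : Ideal A, I ≠ ⊥ ∧
      Scheme.IsRegular (affineBlowup I)

/-- The crux unfolds to `∀ p prime, ∀ d, OneShot p d → Almost p (d+1) → OneShot p (d+1)`. [folklore] -/
theorem crux_iff : FibrewiseClosedPoints ↔
    ∀ p : ℕ, p.Prime → ∀ d : ℕ, OneShot p d → Almost p (d + 1) → OneShot p (d + 1) :=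
  Iff.rfl

/-- The target unfolds to `∀ p prime, ∀ d, OneShot p d`. [folklore] -/
theorem target_iff : OneShotAffine ↔ ∀ p : ℕ, p.Prime → ∀ d : ℕ, OneShot p d :=
  Iff.rfl

/-! ## §2 Kernel status: `Almost` holds outright; the crux IS the target -/

/-- `Almost p d` holds for all `p, d` — the normalisation `Spec Ã = Bl_{gÃ}(Spec A)` is a witness
(landed `Theorems.exists_ideal_almost_of_normalization`; neither `p` nor the dimension is used).
[folklore] -/
theorem almost_all (p d : ℕ) : Almost p d :=
  fun K _ _ A _ _ _ _ _ =>
    Summit.ResolutionOfSingularities.ResolutionOfSingularities.Theorems.exists_ideal_almost_of_normalization K A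

/-- `OneShot p 0` is vacuous: an integral domain has `ringKrullDim ≥ 0`. [folklore] -/
theorem oneShot_zero (p : ℕ) : OneShot p 0 := by
  intro K _ _ A _ _ _ _ hdim
  exfalso
  have h0 : (0 : WithBot ℕ∞) ≤ ringKrullDim A := ringKrullDim_nonneg_of_nontrivial
  exact absurd hdim (not_lt.mpr (by simpa using h0))

/-- **The crux is the target**: `FibrewiseClosedPoints ↔ OneShotAffine` (induction on `d` with
`almost_all`; `←` by instantiation). Consequently ¬crux needs an affine variety in characteristic
`p` NONE of whose `Sing`-cosupported centres has a regular blowing up. [folklore] -/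
theorem crux_iff_target : FibrewiseClosedPoints ↔ OneShotAffine := by
  -- proposed verbatim as `Negative/LoadBearing.lean` (`fibrewiseClosedPoints_iff_oneShotAffine`)
  constructor
  · intro h
    by_contra hO
    exact not_fibrewiseClosedPoints_of_not_oneShotAffine (fun p _ d => almost_all p d) hO h
  · intro h p hp d _ _
    exact h p hp (d + 1)

/-! ## §3 Load-bearing analysis: every hypothesis-dropped variant is the target again -/

/-- The crux with `Almost p (d+1)` DROPPED: the bare inductive step. [folklore] -/
def FibrewiseClosedPointsWithoutAlmost : Prop :=
  ∀ p : ℕ, p.Prime → ∀ d : ℕ, OneShot p d → OneShot p (d + 1)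

/-- The crux with the induction hypothesis `OneShot p d` DROPPED. [folklore] -/
def FibrewiseClosedPointsWithoutOneShotHyp : Prop :=
  ∀ p : ℕ, p.Prime → ∀ d : ℕ, Almost p (d + 1) → OneShot p (d + 1)

/-- The crux with `p.Prime` DROPPED (so `p = 0`, characteristic zero, is included; `p` composite
or `1` is vacuous for fields). [folklore] -/
def FibrewiseClosedPointsWithoutPrime : Prop :=
  ∀ p d : ℕ, OneShot p d → Almost p (d + 1) → OneShot p (d + 1)

/-- **`Almost` is not load-bearing**: `crux ↔ cruxWithoutAlmost`. No `_false_without_Almost`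
exists unless the target fails. [folklore] -/
theorem iff_withoutAlmost : FibrewiseClosedPoints ↔ FibrewiseClosedPointsWithoutAlmost := by
  constructor
  · intro h p hp d hd
    exact h p hp d hd (almost_all p (d + 1))
  · intro h p hp d hd _
    exact h p hp d hd

/-- **`OneShot p d` is not load-bearing as a statement**: `crux ↔ cruxWithoutOneShotHyp` (both are
the target). A proof by induction still consumes it; a disproof cannot exploit it. [folklore] -/
theorem iff_withoutOneShotHyp : FibrewiseClosedPoints ↔ FibrewiseClosedPointsWithoutOneShotHyp := by
  constructor
  · intro h p hp d _
    exact (crux_iff_target.mp h) p hp (d + 1)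
  · intro h p hp d _ hA
    exact h p hp d hA

/-- **`p.Prime` is load-bearing exactly for characteristic `0`**: the prime-free variant is the crux
AND the characteristic-zero target `∀ d, OneShot 0 (d+1)` (Hironaka's theorem in strong projective
form for affine varieties — TRUE, but the tree's named fact `Hironaka1964` is the weak form, so this
conjunct is not derivable here); composite `p` and `p = 1` contribute nothing (a field has
characteristic `0` or a prime, `CharP.char_is_prime_or_zero`). [folklore] -/
theorem withoutPrime_iff :
    FibrewiseClosedPointsWithoutPrime ↔ FibrewiseClosedPoints ∧ ∀ d : ℕ, OneShot 0 (d + 1) := by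
  constructor
  · intro h
    refine ⟨fun p _ d hd hA => h p d hd hA, fun d => ?_⟩
    induction d with
    | zero => exact h 0 0 (oneShot_zero 0) (almost_all 0 1)
    | succ d ih => exact h 0 (d + 1) ih (almost_all 0 (d + 2))
  · rintro ⟨hcrux, h0⟩ p d hd hA
    by_cases hp : p.Prime
    · exact hcrux p hp d hd hA
    · by_cases hp0 : p = 0
      · subst hp0
        exact h0 d
      · -- no field has characteristic `p` when `p ≠ 0` is not prime: the level is vacuous
        intro K _ _ A _ _ _ _ _
        exfalso
        rcases CharP.char_is_prime_or_zero K p with h | h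
        · exact hp h
        · exact hp0 h

/-! ## §4 Level structure: where the open problem sits -/

/-- Levels are cumulative: `OneShot p e → OneShot p d` for `d ≤ e`. [folklore] -/
theorem oneShot_antitone (p : ℕ) {d e : ℕ} (hde : d ≤ e) (h : OneShot p e) : OneShot p d := by
  intro K _ _ A _ _ _ _ hdim
  exact h K A (lt_of_lt_of_le hdim (by exact_mod_cast hde))

/-- `OneShot p 1` holds (dimension-`0` domains are fields; landed `oneShotBody_one`). [folklore] -/
theorem oneShot_one (p : ℕ) : OneShot p 1 :=
  fun _ _ _ A _ _ _ _ hdim => oneShotBody_one A hdim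

/-- **The crux is the family of its conclusions**: `crux ↔ ∀ p prime, ∀ d, OneShot p (d+1)`.
STATUS IN PRINT of `OneShot p (d+1)`: `d+1 = 1` Lean (`oneShot_one`); `= 2` curves (conductor
blow-up = normalisation, Liu 2002 Lemma 8.3.47 (a)); `= 3` excellent surfaces (Lipman, Liu 2002
Thm 8.3.44, one `Sing`-cosupported blow-up via negative definiteness); `= 4` threefolds OPEN —
Cossart–Piltant, arXiv:1412.0868 p. 3, verbatim: "it is not even known if such π can be obtained by
blowing up an ideal sheaf 𝓘 ⊆ 𝒪_𝒳 whose zero locus is Sing 𝒳, even when 𝒳 is affine"; `≥ 5` open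
with resolution itself. So the FIRST OPEN INSTANCE of the crux is `d = 3` (not `4`).
[cite: CossartPiltant2019, Thm 1.1 and p. 3] -/
theorem crux_iff_forall_succ :
    FibrewiseClosedPoints ↔ ∀ p : ℕ, p.Prime → ∀ d : ℕ, OneShot p (d + 1) := by
  rw [crux_iff_target, target_iff]
  constructor
  · intro h p hp d
    exact h p hp (d + 1)
  · intro h p hp d
    cases d with
    | zero => exact oneShot_zero p
    | succ d => exact h p hp d

/-- **Boundary**: the instance `d = 0` of the crux holds, so any failure has `d ≥ 1` (in print
`d ≥ 3`). [folklore] -/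
theorem crux_instance_zero (p : ℕ) : OneShot p 0 → Almost p 1 → OneShot p 1 :=
  fun _ _ => oneShot_one p

/-- The crux fails iff some level fails: `¬crux ↔ ∃ p prime, ∃ d, ¬OneShot p (d+1)` — the only
shape a disproof can take. [folklore] -/
theorem not_crux_iff : ¬ FibrewiseClosedPoints ↔ ∃ p : ℕ, p.Prime ∧ ∃ d : ℕ, ¬ OneShot p (d + 1) := by
  rw [crux_iff_forall_succ]
  push Not
  rfl

/-! ## §5 Line `registered` (`Lines/birth.lean`): the open stubs against the target -/

/-- Body of the line's `stub_supportSharpening` ("strong from weak one-shot resolution"), verbatim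
`Lines.Birth.SupportSharpening`. [cite: CossartPiltant2019, p. 3] -/
def SupportSharpening : Prop :=
  ∀ (p : ℕ), p.Prime → ∀ (K : Type) [Field K] [CharP K p] (A : Type) [CommRing A] [IsDomain A]
    [Algebra K A] [Algebra.FiniteType K A] (I : Ideal A), I ≠ ⊥ →
    Scheme.IsRegular (affineBlowup I) →
    ∃ I' : Ideal A, I' ≠ ⊥ ∧ Scheme.IsRegular (affineBlowup I') ∧
      ∀ 𝔭 : PrimeSpectrum A, I' ≤ 𝔭.asIdeal ↔ ¬ IsRegularLocalRing (Localization.AtPrime 𝔭.asIdeal)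

/-- **`stub_supportSharpening` is implied by the target** (the weak witness is not used: a domain of
finite type over a field has some finite Krull dimension `n`, tree
`exists_ringKrullDim_eq_and_trdeg_eq`, and the target applies at level `n + 1`). So a refutation of
the stub refutes the crux; none is in sight. [folklore] -/
theorem supportSharpening_of_target (h : OneShotAffine) : SupportSharpening := by
  intro p hp K _ _ A _ _ _ _ _ _ _
  obtain ⟨n, hn, -⟩ := exists_ringKrullDim_eq_and_trdeg_eq K A
  refine h p hp (n + 1) K A ?_
  rw [hn]
  exact_mod_cast Nat.lt_succ_self n

/-- **The stub is EXACTLY the gap weak ⇒ strong**: `target ↔ (∀ p prime d, WeakOneShot p d) ∧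
SupportSharpening`. In dimension `3` weak one-shot is in print (Cossart–Piltant Thm 1.1 + Liu 2002
Thm 8.1.24: a projective resolution of an affine threefold is SOME blowing up) and strong is their
open question — so restricted to threefolds the stub is that open question; it is a theorem in
dimension `≤ 2` only (the line card's "known in dim ≤ 3" overstates by one).
[cite: CossartPiltant2019, Thm 1.1 and p. 3] -/
theorem target_iff_weak_and_supportSharpening :
    OneShotAffine ↔ (∀ p : ℕ, p.Prime → ∀ d : ℕ, WeakOneShot p d) ∧ SupportSharpening := by
  constructor
  · intro h
    refine ⟨fun p hp d K _ _ A _ _ _ _ hdim => ?_, supportSharpening_of_target h⟩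
    obtain ⟨I, hI, hreg, -⟩ := h p hp d K A hdim
    exact ⟨I, hI, hreg⟩
  · rintro ⟨hweak, hsharp⟩ p hp d K _ _ A _ _ _ _ hdim
    obtain ⟨I, hI, hreg⟩ := hweak p hp d K A hdim
    exact hsharp p hp K A I hI hreg

/-- The crux through the line, in one formula: `crux ↔ (∀ weak) ∧ SupportSharpening` — the line's
`stub_weakSectionLift` + criterion deliver exactly `∀ weak` (paper: the lift is implied by weak
one-shot at level `d + 1` via `g` = generators of `(𝔭_y)_m`, `m ≫ 0`, incidence Bertini on the
regular `Bl_I ⊗_K K(t)` and `c_j ∉ 𝔪_y²` at `P`), and `stub_supportSharpening` the rest. [folklore] -/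
theorem crux_iff_weak_and_supportSharpening :
    FibrewiseClosedPoints ↔ (∀ p : ℕ, p.Prime → ∀ d : ℕ, WeakOneShot p d) ∧ SupportSharpening := by
  rw [crux_iff_target, target_iff_weak_and_supportSharpening]

/-! ## §6 Natural strengthenings: one refuted in the kernel, the rest on paper -/

/-- WEAK one-shot resolution with a PRINCIPAL centre, level `d`. [folklore] -/
def WeakOneShotPrincipal (p d : ℕ) : Prop :=
  ∀ (K : Type) [Field K] [CharP K p] (A : Type) [CommRing A] [IsDomain A] [Algebra K A]
    [Algebra.FiniteType K A], ringKrullDim A < (d : WithBot ℕ∞) →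
      ∃ f : A, f ≠ 0 ∧ Scheme.IsRegular (affineBlowup (Ideal.span {f}))

/-- **Refuted strengthening (kernel): the conclusion of the crux is not junk-satisfiable.** For
every prime `p`, `WeakOneShotPrincipal p 2` is FALSE: the nodal cubic `Y² = X²(X-1)` over `𝔽_p`
(irreducible by Eisenstein at `(X-1)`, singular at the origin since `f ∈ 𝔪_0²`) admits no nonzero
`f` with `Bl_(f)` regular, `Bl_(f) → Spec A` being an isomorphism (landed
`Negative/PrincipalCentre.lean`, `not_weakOneShotBody_two_principal`). Contrast: the HYPOTHESIS
`Almost` is met by principal centres (landed `almostBody_span_singleton`). So from level `2` on any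
proof must produce centres that are not invertible at the singular points. [folklore] -/
theorem not_weakOneShotPrincipal_two (p : ℕ) [Fact p.Prime] : ¬ WeakOneShotPrincipal p 2 :=
  not_weakOneShotBody_two_principal p

/-- Hence `OneShot p 2` itself is not witnessed by principal centres (it asks more). [folklore] -/
theorem not_oneShot_two_principal (p : ℕ) [Fact p.Prime] :
    ¬ ∀ (K : Type) [Field K] [CharP K p] (A : Type) [CommRing A] [IsDomain A] [Algebra K A]
        [Algebra.FiniteType K A], ringKrullDim A < ((2 : ℕ) : WithBot ℕ∞) →
        ∃ f : A, f ≠ 0 ∧ Scheme.IsRegular (affineBlowup (Ideal.span {f})) ∧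
          ∀ 𝔭 : PrimeSpectrum A, Ideal.span {f} ≤ 𝔭.asIdeal ↔
            ¬ IsRegularLocalRing (Localization.AtPrime 𝔭.asIdeal) :=
  not_oneShotBody_two_principal p

/-! The other strengthenings refuted on paper ("radical centre": `y² = x⁵`, `Bl_𝔪` has an `A₂`
point; "the `Almost` witness is regular": normalisation of a normal singular surface; "same centre up
to radical": the small resolution of `xy = zw`) are not the crux and are recorded only to save the
provers' time; the junk certificate (cusp, `I = (x)`, `g = x²`) showing that `hnorm ∧ hdim` is
jointly load-bearing in `stub_certificateRegular` is on paper in the module docstring. No `sorry`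
is carried. -/

/-! ## §7 Generation 2, cycle 1 (2026-08-17): the clauses separating `OneShot` from `Almost`, and
why the obvious repair of the crux does not help

The crux is the target (§2), so this cycle does not look for a counterexample; it attacks the two
clauses by which the conclusion `OneShot` exceeds the hypothesis `Almost` — EXACT SUPPORT
(`I ≤ 𝔭 ↔ A_𝔭 singular` versus `V(I) ⊇ Sing`) and REGULAR (versus normal + regular off fibre-closed
points) — because the planner's restatement must decide which of them to move into the
intermediate predicate. Kernel results are in §7.1 (two landed/proposed `Negative/` files and the
crux-level corollaries below); §7.2–7.3 are on paper. -/

/-! ### §7.1 Kernel -/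

/-- **The conjunct `I ≠ ⊥` of `OneShot` is implied by its support clause** (decoration inside the
conclusion): at the generic point `𝔭 = 0` of the domain `A` the local ring is the fraction field,
regular, so the clause forbids `I ≤ 0`. [folklore] -/
theorem ne_bot_of_exactSupport {A : Type} [CommRing A] [IsDomain A] {I : Ideal A}
    (h : ∀ 𝔭 : PrimeSpectrum A, I ≤ 𝔭.asIdeal ↔
      ¬ IsRegularLocalRing (Localization.AtPrime 𝔭.asIdeal)) : I ≠ ⊥ := by
  intro hI
  have hfield : IsField (Localization.AtPrime (⊥ : Ideal A)) := by
    rw [IsLocalRing.isField_iff_maximalIdeal_eq, ← Localization.AtPrime.map_eq_maximalIdeal,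
      Ideal.map_bot]
  have hreg : IsRegularLocalRing (Localization.AtPrime (⊥ : Ideal A)) := by
    letI := hfield.toField
    infer_instance
  exact (h ⟨⊥, Ideal.isPrime_bot⟩).mp (by rw [hI]) hreg

/-- Hence `OneShot p d` is equivalent to its variant WITHOUT the conjunct `I ≠ ⊥` (one goal fewer
for provers; nothing for a disprover). [folklore] -/
theorem oneShot_iff_withoutNeBot (p d : ℕ) : OneShot p d ↔
    ∀ (K : Type) [Field K] [CharP K p] (A : Type) [CommRing A] [IsDomain A] [Algebra K A]
      [Algebra.FiniteType K A], ringKrullDim A < (d : WithBot ℕ∞) → ∃ I : Ideal A,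
        Scheme.IsRegular (affineBlowup I) ∧
        ∀ 𝔭 : PrimeSpectrum A, I ≤ 𝔭.asIdeal ↔
          ¬ IsRegularLocalRing (Localization.AtPrime 𝔭.asIdeal) := by
  constructor
  · intro h K _ _ A _ _ _ _ hdim
    obtain ⟨I, -, hreg, hsupp⟩ := h K A hdim
    exact ⟨I, hreg, hsupp⟩
  · intro h K _ _ A _ _ _ _ hdim
    obtain ⟨I, hreg, hsupp⟩ := h K A hdim
    exact ⟨I, ne_bot_of_exactSupport hsupp, hreg, hsupp⟩

/-- **`OneShot` centres are never invertible at a normal singular variety** (crux-level corollary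
of the landed `Negative/ExactSupport.lean`, p163004): for a normal domain `A` with a non-regular
local ring, no principal ideal satisfies even the support clause of the `OneShot` body — in every
dimension and characteristic, before any blowing up is formed. Contrast §6 (principal centres fail
the WEAK conclusion at the nodal cubic because `Bl_(f) ≅ Spec A` is singular) and
`almostBody_span_singleton` (principal centres DO satisfy the hypothesis `Almost`). Normal singular
affine varieties exist from dimension `2` on in every characteristic (`K[s², st, t²]`), so from
level `d + 1 = 3` the conclusion needs non-invertible centres at normal inputs. [folklore] -/
theorem oneShot_centre_not_principal {A : Type} [CommRing A] [IsDomain A] [IsNoetherianRing A]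
    [IsIntegrallyClosed A]
    (hsing : ∃ 𝔮 : PrimeSpectrum A, ¬ IsRegularLocalRing (Localization.AtPrime 𝔮.asIdeal))
    (f : A) :
    ¬ (Ideal.span {f} ≠ ⊥ ∧ Scheme.IsRegular (affineBlowup (Ideal.span {f})) ∧
        ∀ 𝔭 : PrimeSpectrum A, Ideal.span {f} ≤ 𝔭.asIdeal ↔
          ¬ IsRegularLocalRing (Localization.AtPrime 𝔭.asIdeal)) :=
  fun ⟨_, _, hsupp⟩ => not_exactSupport_span_singleton hsing f hsupp

/-- **The repaired intermediate** the planner is advised to consider (docstring of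
`Negative/RestatesTarget.lean`): `Almost` with EXACT support. [folklore] -/
def AlmostExact (p d : ℕ) : Prop :=
  ∀ (K : Type) [Field K] [CharP K p] (A : Type) [CommRing A] [IsDomain A] [Algebra K A]
    [Algebra.FiniteType K A], ringKrullDim A < (d : WithBot ℕ∞) → ∃ I : Ideal A, I ≠ ⊥ ∧
      (∀ 𝔭 : PrimeSpectrum A, I ≤ 𝔭.asIdeal ↔
        ¬ IsRegularLocalRing (Localization.AtPrime 𝔭.asIdeal)) ∧
      (∀ y : affineBlowup I, IsIntegrallyClosed ((affineBlowup I).presheaf.stalk y)) ∧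
      ∀ y : affineBlowup I, (∃ z : affineBlowup I, z ≠ y ∧ y ⤳ z ∧
        (affineBlowup.π I).base z = (affineBlowup.π I).base y) →
        IsRegularLocalRing ((affineBlowup I).presheaf.stalk y)

/-- `AlmostExact` refines `Almost` (exact support implies `D(I) ⊆ Reg`). [folklore] -/
theorem almost_of_almostExact {p d : ℕ} (h : AlmostExact p d) : Almost p d := by
  intro K _ _ A _ _ _ _ hdim
  obtain ⟨I, hI, hsupp, hnorm, hfib⟩ := h K A hdim
  refine ⟨I, hI, fun 𝔭 h𝔭 => ?_, hnorm, hfib⟩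
  by_contra hn
  exact h𝔭 ((hsupp 𝔭).mpr hn)

/-- `OneShot` implies `AlmostExact` (a regular blowing up has integrally closed stalks — tree
`isIntegrallyClosed_of_isRegularLocalRing` — and is regular at every point). So the repaired
intermediate sits between the conclusion and the original hypothesis, as an intermediate should.
[folklore] -/
theorem almostExact_of_oneShot {p d : ℕ} (h : OneShot p d) : AlmostExact p d := by
  intro K _ _ A _ _ _ _ hdim
  obtain ⟨I, hI, hreg, hsupp⟩ := h K A hdim
  refine ⟨I, hI, hsupp, fun y => ?_, fun y _ => hreg y⟩
  haveI : IsRegularLocalRing ((affineBlowup I).presheaf.stalk y) := hreg y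
  exact Literature.AlgebraicGeometry.Resolution.isIntegrallyClosed_of_isRegularLocalRing _

/-- The repaired crux: the inductive step through `AlmostExact`. [folklore] -/
def FibrewiseClosedPointsExact : Prop :=
  ∀ p : ℕ, p.Prime → ∀ d : ℕ, OneShot p d → AlmostExact p (d + 1) → OneShot p (d + 1)

/-- The crux (≡ target) implies the repaired crux; the converse is NOT claimed — but §7.2 shows on
paper that the repaired crux still contains the inductive step "strong one-shot below `d` ⇒
resolution of every normal affine `d`-fold", because `AlmostExact p (d+1)` is junk-satisfied at the
pinched varieties (kernel part: landed `Negative/ConductorSupport.lean`, p163578,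
`exactAlmostBody_of_conductor_elem`; crux-level form `almostExactBody_junk_of_conductor_elem` below).
[folklore] -/
theorem fibrewiseClosedPointsExact_of_crux (h : FibrewiseClosedPoints) :
    FibrewiseClosedPointsExact :=
  fun p hp d _ _ => (crux_iff_target.mp h) p hp (d + 1)

/-- What the repaired crux DOES settle cheaply: together with `AlmostExact` at every level it gives
the target by the same induction (so a planner filing it must file `AlmostExact p (d+1)` — from
`OneShot p d` — as the companion crux, and THAT companion is where §7.2's junk lives). [folklore] -/
theorem forall_oneShot_of_cruxExact_of_almostExact (h : FibrewiseClosedPointsExact)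
    (hA : ∀ p : ℕ, p.Prime → ∀ d : ℕ, OneShot p d → AlmostExact p (d + 1)) :
    ∀ p : ℕ, p.Prime → ∀ d : ℕ, OneShot p d := by
  intro p hp d
  induction d with
  | zero => exact oneShot_zero p
  | succ d ih => exact h p hp d ih (hA p hp d ih)

/-- **The `AlmostExact` body is junk-satisfied, in the kernel** (crux-level form of the landed
`Negative/ConductorSupport.lean`, p163578): for a domain `A` with a conductor element `f ≠ 0`
(`f·Ã ⊆ A`) cutting out `Sing(Spec A)` exactly and a normalisation `Ã` that is singular somewhere,
there is an ideal meeting EVERY clause of the `AlmostExact` body at `A` whose blowing up is NOT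
regular (it is `Spec Ã`, finite over `A`, fibre clause vacuous). §7.2 supplies such `A` with `Ã` any
normal singular affine variety (pinching, paper). [folklore] -/
theorem almostExactBody_junk_of_conductor_elem (A : Type) [CommRing A] [IsDomain A] (f : A)
    (hf0 : f ≠ 0)
    (hcond : ∀ x : FractionRing A, x ∈ integralClosure A (FractionRing A) →
      ∃ a : A, algebraMap A (FractionRing A) a = algebraMap A (FractionRing A) f * x)
    (hsing : ∀ 𝔭 : PrimeSpectrum A, f ∈ 𝔭.asIdeal →
      ¬ IsRegularLocalRing (Localization.AtPrime 𝔭.asIdeal))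
    (hreg : ∀ 𝔭 : PrimeSpectrum A, f ∉ 𝔭.asIdeal →
      IsRegularLocalRing (Localization.AtPrime 𝔭.asIdeal))
    (hÃ : ∃ 𝔓 : PrimeSpectrum (integralClosure A (FractionRing A)),
      ¬ IsRegularLocalRing (Localization.AtPrime 𝔓.asIdeal)) :
    ∃ I : Ideal A, (I ≠ ⊥ ∧
      (∀ 𝔭 : PrimeSpectrum A, I ≤ 𝔭.asIdeal ↔
        ¬ IsRegularLocalRing (Localization.AtPrime 𝔭.asIdeal)) ∧
      (∀ y : affineBlowup I, IsIntegrallyClosed ((affineBlowup I).presheaf.stalk y)) ∧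
      ∀ y : affineBlowup I, (∃ z : affineBlowup I, z ≠ y ∧ y ⤳ z ∧
        (affineBlowup.π I).base z = (affineBlowup.π I).base y) →
          IsRegularLocalRing ((affineBlowup I).presheaf.stalk y)) ∧
      ¬ Scheme.IsRegular (affineBlowup I) := by
  obtain ⟨I, hI, hsupp, hnorm, hfib, hnreg⟩ :=
    not_isRegular_affineBlowup_of_conductor_elem A f hf0 hcond hsing hreg hÃ
  exact ⟨I, ⟨hI, hsupp, hnorm, hfib⟩, hnreg⟩

/-! ### §7.2 (paper) The exact-support repair is junk-satisfiable at pinched varieties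

KERNEL PART (landed `Negative/ConductorSupport.lean`, p163578; same one-chart mechanism as the
landed `Theorems.exists_ideal_almost_of_normalization` with `b = c = f`):
`exactAlmostBody_of_conductor_elem` — if `A` is a domain and `0 ≠ f ∈ A` is a CONDUCTOR element
(`f·Ã ⊆ A`) with `V(f) = Sing(Spec A)` exactly, then `I := f²Ã ⊆ A` satisfies the `AlmostExact` body
(exact support, integrally closed stalks, fibre clause) with `Bl_I(Spec A) = D₊(f²t) = Spec Ã`
FINITE over `A` (no proper specialisation inside a fibre: the fibre clause is vacuous again), and
`not_isRegular_affineBlowup_of_conductor_elem` — this admissible blowing up is not regular when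
`Ã` is not.

PAPER PART (existence, every characteristic, every dimension `n ≥ 2`): PINCHING (Ferrand,
*Conducteur, descente et pincement*, Bull. SMF 131 (2003), Thm 5.4 p. 570 — the pinched
`X = X' ⊔_{Y'} Y` along a finite `g : Y' → Y` is a scheme, `X' → X` finite, iso off `Y`; finite type
over `k` by Bourbaki AC V p. 33 Lemme 5, ibid. §6.1 p. 574 — read 2026-08-17). Let `Y = Spec B`
be ANY normal affine variety of finite type over `K` with `Sing Y ≠ ∅` (e.g. `K[s², st, t²][w₃…w_n]`,
normal as a Veronese/invariant ring, singular at the vertex in every characteristic), `0 ≠ f ∈ B`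
with `Sing Y ⊆ V(f)` (J-2). Let `P = K[u₁, …, u_{n-1}] ⊆ B/fB` be a Noether normalisation and
`C := K[u₁², u₂, …, u_{n-1}] ⊊ P`; put `A := {b ∈ B | b mod fB ∈ C}`. Then: `fB ⊆ A`; `B = A + Σ A eᵢ`
for lifts `eᵢ` of module generators of `B/fB` over `C` (finite); `A` is of finite type over `K`
(Artin–Tate); `Frac A = Frac B` (`b = fb/f`); `Ã = B`. Non-normal locus:
`NonNor(A) = Supp_A(B/A) = Supp_C((B/fB)/C) ⊇ Supp_C(P/C) = Spec C` (`P/C ≅ C·u₁` is free), i.e.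
`NonNor(A) = V_A(fB) = V_A(f)` (`(fb)² = f·(fb²)`); off `V(f)`: `A_𝔭 = B_𝔓` with `f ∉ 𝔓`, regular
since `Sing B ⊆ V(f)`. Hence `Sing A = V_A(f)` EXACTLY, `f` is a conductor element, and the kernel
part applies: `AlmostExact` holds at `A` with witness `Spec B`, `B` normal SINGULAR.

CONSEQUENCE. `AlmostExact p (d+1)` restricted to pinched `A` of dimension `d` carries no
information, and the repaired crux at such `A` must output `Bl_{I'}(A)` regular — a resolution of
the arbitrary normal `d`-fold `Y` (it factors through `Spec Ã = Y`, `X'` being normal). So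
`FibrewiseClosedPointsExact` ⊇ "`OneShot p d` ⇒ every normal affine `d`-fold over a field of
characteristic `p` has a resolution that is a `Sing(A)`-exact blowing up of its pinchings" ⊇ the
weak inductive step for normal varieties — as hard as `stub_weakSectionLift` (`weakSectionLift_iff`).
ADVICE TO THE PLANNER (not filed here): restrict the induction to NORMAL `A` (then `ExactSupport`
forbids finite witnesses at singular points, ZMT gives positive-dimensional fibres, and the clause
"regular off fibre-closed points" acquires content: for surfaces it is R₁ = free, for threefolds it
is "no vertical singular curves"), and reduce `OneShot` for general `A` to the normal case
separately: if `J ⊆ Ã` has `Bl_J(Ã)` regular and `V(J) = ν⁻¹(Sing A)` then `Jᵏ ⊆ 𝔣 ⊆ A` for `k ≫ 0`,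
`Bl_{Jᵏ}(A) = Bl_{Jᵏ}(Ã) = Bl_J(Ã)` (Rees algebras agree in positive degrees for an `Ã`-ideal inside
`A`) and `V_A(Jᵏ) = Sing A` — so the general case needs `OneShot` for normal varieties WITH
PRESCRIBED SUPPORT `F ⊇ Sing` (`F = ν⁻¹(Sing A)`), a principalisation-flavoured variant. -/

/-! ### §7.3 (paper) The one-shot presentation problem behind `stub_supportSharpening`

CRITERION. Let `π : X' → X = Spec A` be projective birational, `X'` regular, an isomorphism over
`Reg X`. If `X' ≅ Bl_I(X)` with `V(I) = Sing X` then `I·𝒪_{X'} = 𝒪(-F)` with `F` effective Cartier,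
`Supp F = π⁻¹(Sing X)` EXACTLY and `-F` `π`-ample. Conversely, given such `F`: the section ring
`S = ⊕ₖ Γ(X', 𝒪(-kF))` is finitely generated with `S₀ = Ã`, a Veronese `S^{(N)}` is generated in
degree `1`, `X' = Proj S^{(N)} = Bl_{J_N}(Spec Ã)` with `J_N = Γ(𝒪(-NF)) ⊆ Ã`, `J_N·𝒪 = 𝒪(-NF)`,
`V(J_N) = ν⁻¹(Sing X)`; for NORMAL `A` this is the one-shot presentation (`V(J_N) = Sing`). For
non-normal `A`: arrange first that the conductor is principal upstairs (start from `Bl_𝔣(X)`, whose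
further modifications keep `𝔣·𝒪` invertible), then `I := 𝔣·J_N ⊆ 𝔣 ⊆ A` is an `A`-ideal and an
`Ã`-ideal, `Bl_I(A) = Bl_I(Ã) = X'` (it principalises `𝔣` and `J_N`; conversely invertibility of a
product of ideals on an integral scheme forces each factor invertible), `V_A(I) = NonNor ∪ Sing = Sing`.

CONSEQUENCES. (i) `Supp F = π⁻¹(Sing)` is divisorial (kernel heart:
`Negative.exists_mem_and_lt_maximalIdeal`, p163004): a SMALL strong resolution — `Bl_{(x,z)}` of
the cone `xy = zw`, iso off the vertex, exceptional `ℙ¹` — is never one-shot, so "projective, iso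
over `Reg`" (Cossart–Piltant Thm 1.1 (i)(ii)) does not give `OneShot` by itself, and Hartshorne
II.7.17 presents `π` as `Bl_J` with NO control of `V(J)` (the small resolution shows `V(J) ⊆ Sing`
cannot be imposed in general). (ii) For a SEQUENCE of blowings up with centres over `Sing`, a
positive combination of the (pulled-back) exceptional divisors is `π`-anti-ample with full support
— automatic one-shot form (this is how characteristic `0` and Lipman's surfaces, normalisations
included as conductor-cosupported blowings up, give `OneShot p (d+1)` for `d + 1 ≤ 3`). (iii) For
NORMAL ℚ-FACTORIAL `X` EVERY strong projective resolution is one-shot: with `H` `π`-ample and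
`m·π_*H` Cartier, `D := mH - π^*(m π_*H)` is `π`-ample and `π`-exceptional with `π_*D = 0`, so by
the negativity lemma (Kollár–Mori 3.39; proof = Hodge index on surfaces after hyperplane cuts,
characteristic-free over an algebraically closed field — over an arbitrary base field take this
as EXPECTED, not cited) `D = -F` with `F` effective and `Supp F ⊇ π⁻¹(x)` for every `x` over which
`π` is not an isomorphism (else the `π`-ample `D` would vanish on a positive-dimensional fibre,
ZMT) — `Supp F = π⁻¹(Sing X)`.
Hence `OneShot p 4` (threefolds) is open EXACTLY at non-ℚ-factorial normal threefolds (cones over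
quadrics and the like, where small resolutions live) and at the conductor principalisation for
non-normal ones; Cossart–Piltant resolve by PATCHING local uniformisations, not by a blow-up
sequence, which is why their p. 3 calls the blow-up presentation unknown "even when 𝒳 is affine".
Generation 1's correction of the route header ("first open instance `d = 3`, not `4`") stands, with
this mechanism; for `stub_supportSharpening` (weak ⇒ strong one-shot) the honest size is therefore
"control the divisor class group obstruction, or re-resolve by blow-up sequences" — open.

TARGETS. None posted (`stuck_stubs = []`); the lead picked no line (PICKED: none); the two open
stubs of `birth` are open problems as calibrated in §5 and unchanged. No `sorry` is carried. -/

end Summit.ResolutionOfSingularities.ResolutionOfSingularities.Cruxes.FibrewiseClosedPoints.Disproof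

end
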